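import Summits.Parity.GeneralizedHardyLittlewood.Theses.VarianceWitness

/-!
# Line `zeros` — crux stmt-Parity-18096 `Theses.VarianceWitness.TwistedVarianceRate` (rank 3)
# TRANSFER TO ZERO LANGUAGE: twisted explicit formula ∧ thin-box zero-free region ∧ bulk window
# zero-density (two modulus ranges) ⟹ the twisted class-variance rate (strategist alternative to `birth`)

Strategist line (planner-cstrat-stmt-Parity-18096-s1-0, 2026-08-17) for route
`route-Parity-VarianceWitness` (rev 14). ALTERNATIVE to the birth line (`Lines/birth.lean`, cut by
modulus size into Gallagher's range `q ≤ x^{κ₀(ε,B)}` and Hooley's range, both halves open). This line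
cuts the crux by MECHANISM, along the explicit formula. By Parseval
`φ(q)·V_Λ(x;q,τ) = Σ_{χ ≠ χ₀ mod q} |ψ(x,χ,τ)|²`, `ψ(x,χ,τ) = Σ_{n ≤ x} Λ(n)χ(n)n^{−iτ}`, and
`ψ(x,χ,τ) = −Σ_ρ m(ρ) x^{ρ−iτ}/(ρ−iτ) + O(√x log³(qx))` (zeros `ρ = β+iγ` of `L(s,χ)`, `β ≥ 1/2`,
`|γ − τ| ≤ √x`), so the crux is a statement about two classical ZERO STATISTICS of the family
`{L(s,χ) : χ mod q}` in unit height windows up to height `x`: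

* `stub_twistedExplicitFormula` (E, PROVABLE NOW, L/XL) — Montgomery–Vaughan Thm 12.10 for
  `L(s + iτ, χ)`: non-principal `χ` mod `q ≤ x`, `|τ| ≤ x`, `2 ≤ T ≤ x`, zeros `1/2 ≤ β < 1`,
  `|γ − τ| ≤ T` (with multiplicity) on the main side, everything else (Perron, contour, trivial zeros,
  the poles at `s = 0, −iτ`, the zeros with `β < 1/2` incl. the reflected exceptional zero, which
  cancels against the constant `L'/L`-term as in MV §12.1, imprimitive `χ`) in the error
  `K (x/T + √x) log³(qx)`. The `τ = 0` case is PROVED in the tree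
  (`Literature.NumberTheory.LFunctions.truncatedExplicitFormula_psiChar_holds`; window counts and good
  heights uniform in the height in `ExplicitFormulaPsiCharHeights.lean`).
* `stub_thinBoxZeroFree` (Z, OPEN — the q-ASPECT ZERO-FREE REGION WIDENED BY AN UNBOUNDED FACTOR):
  ∀ κ > 0 ∀ A, eventually every zero `s` of every `L(s,χ)`, `χ ≠ χ₀ mod q ≤ x^{1−κ}`, `|Im s| ≤ x`, has
  `Re s ≤ 1 − A log log x / log x`. GRH-implied; for FIXED `q` a theorem (Vinogradov–Korobov; tree,
  conditional on `Khale2024_zeroFreeRegion`); for `q = x^θ` it is `σ > 1 − (A/θ) log log q/log q`,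
  `|t| ≤ q^{1/θ}` — beyond the classical `c/log q(|t|+1)`, the state of the art for general moduli
  (Iwaniec, *Conversations on the exceptional character*, (2.9)); wider regions are known only for
  smooth/powerful moduli (Iwaniec 1974, Chang 2014, Banks–Shparlinski). NECESSARY for the crux in the
  weaker shape `(1−β) log x ≥ (B/2) log log log x + O_ε(1)` (one zero `β₀+iγ₀` of one `χ` gives
  `|ψ(x',χ,γ₀)| ≫ x'^{β₀}` for some `x' ∈ [x, x²]` by Landau/Turán, and `φ(q)V ≥ |ψ|²`): the crux
  contains Landau–Siegel AND its complex-zero analogue.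
* `stub_windowDensitySmall` (D_small, PROVABLE NOW by Ingham–Montgomery zero detection, L/XL) and
  `stub_windowDensityLarge` (D_large, OPEN beyond `q ≈ x^{1/3}`): the BULK WINDOW DENSITY
  `#{(χ,ρ) : χ ≠ χ₀ mod q, L(ρ,χ) = 0, Re ρ ≥ σ, |Im ρ − τ| ≤ 1}` (with multiplicity)
  `≤ C x^{(2−δ)(1−σ)}` for `σ ∈ [1/2, 1 − A₀ log log x/log x]`, `|τ| ≤ x`, for `q ≤ x^{1/8}` resp.
  `x^{1/8} < q ≤ x^{1−κ}`; glued (no `sorry`, `windowDensity_of`) into the full-range statement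
  `Sig.windowDensity` that R consumes; the cut is exact (`windowDensity_iff`). GRH-implied (`δ = κ`). For
  `q = x^θ` it is a zero-density estimate for the q-family in UNIT height windows at height `x` with
  exponent `(2−δ)/θ` in `q`: density-hypothesis strength as `θ → 1`, exponent `4` at `θ = 1/2`;
  Ingham–Montgomery detection with single-modulus orthogonality reaches `θ < 1/3` (class II needs
  `Y ≥ x^{(1+3θ)/2+}` against class I `Y ≤ x^{1−}`), with pointwise convexity alone `θ < 1/5` — hence the
  conservative cut `1/8`. Morally NECESSARY for the crux (`N` characters with zeros at `β ≥ σ` near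
  `τ` force `Σ_χ |ψ(x',χ,τ)|² ≫ N x'^{2σ}/polylog` for some `x' ∈ [x, 2x]`). THIS DENSITY CONTENT of
  the crux at large `q` is NOT recorded in the item's why-might-fail (which names only zeros near 1).
* `stub_zerosToVariance` (R, PROVABLE NOW, M/L; the TRANSFER stub `C⁺ → crux`): E → Z → D → crux, by
  Parseval, E at `T = √x`, Cauchy–Schwarz over windows with the tree's per-character window count
  (`DirichletDisc.exists_sum_zeroOrder_le_of_subset_closedBall`, all `χ ≠ χ₀`), Z and D at scale `2x`,
  partial summation over depth bins: `Σ_{χ≠χ₀}|ψ|² ≪ log³x · x²(log x)^{−δA/2} + x^{2−κ}log⁶x`; take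
  `A > max(A₀ + 1, 10/δ)`.

Composition `TwistedVarianceRate_of : E → Z → D_small → D_large → R → TwistedVarianceRate`
(`windowDensity_of` + modus ponens; `#h21_check_skeleton` OK, closed = true, sorries = the 5 stubs).
Stub signatures are self-contained over Mathlib (`DirichletCharacter.LFunction`, `analyticOrderNatAt`
= the tree's `DirichletDisc.zeroOrder`, `ArithmeticFunction.vonMangoldt`) and the crux decl; no
Literature import (module cone = the route file's, 0 unproved facts). BC3 probes
(`bc/TwistedVarianceRate_zeros_probes{,2}.lean`): `Sig.<stub> → crux` and `→ GeneralizedHardyLittlewood`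
by `exact? | simpa | unfold; simpa | aesop` all FAIL for the five stubs and for `Sig.windowDensity`.

HONEST POSITION. Z and D_large are famous open problems of the theory of Dirichlet L-functions,
INDEPENDENT of the summit; nobody expects to close them on this route. What the zero language buys:
(i) three PROVABLE stubs (E, D_small, R) — referee-grade theorems making "GRH-lite in zero language
⟹ GRH-lite in prime language" a tree theorem, where birth has none; (ii) the crux becomes GRADEABLE:
it is exactly q-aspect ZFR widening (small `q`) plus q-aspect window density (large `q`), so every
partial result lands as a RUNG (Gallagher range = tree theorem `MontgomeryVaughan1975.gallagher_nonexceptional`;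
fixed `q` = VK; smooth moduli = literature); (iii) the disprover gets precise zero-side targets
(`TwistedVarianceRate → Z_min`, `→ D_min`); (iv) tenure learns that re-typing cruxes 2/3 with witness
moduli `q ≤ x^{1/4}` (the scale window `[N, N^B]` of InverseDicksonUniform permits it) deletes D_large
from the crux, leaving the ZFR content only.

Disproof.lean: none exists for this crux. Crux-attack caps honoured: `q ≤ x^{1−κ}` and `|τ| ≤ x`
appear verbatim in Z, D (`q ≤ x^{1−κ}`, `|τ| ≤ x`, `|Im s| ≤ x`) and E (`q ≤ x`, `|τ| ≤ x`).
Negatives index (ConvMomentLevelOne, InverseSieveTuplesTupleElliott, RectangleChowla): unrelated.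
-/

set_option linter.dupNamespace false

noncomputable section

open scoped BigOperators Classical

namespace Summit.Parity.GeneralizedHardyLittlewood.Cruxes.TwistedVarianceRate.Zeros

open Summit.Parity.GeneralizedHardyLittlewood.Theses.VarianceWitness (TwistedVarianceRate)

/-! ## Legend: the stub statements as named propositions (verbatim the stub signatures) -/

/-- Statement of `stub_twistedExplicitFormula` (E): truncated explicit formula for the twisted prime
sum `ψ(x,χ,τ) = Σ_{1 ≤ n ≤ x} Λ(n)χ(n)n^{−iτ}` of a non-principal `χ` mod `q ≤ x`, the zeros
`1/2 ≤ Re ρ < 1`, `|Im ρ − τ| ≤ T` (multiplicity `analyticOrderNatAt` = the tree's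
`DirichletDisc.zeroOrder`) on the main side, error `K (x/T + √x) log³(qx)`. -/
def Sig.stub_twistedExplicitFormula : Prop :=
  ∃ K : ℝ, 0 < K ∧ ∀ (q : ℕ) [NeZero q] (χ : DirichletCharacter ℂ q), χ ≠ 1 → ∀ x : ℕ, 2 ≤ x → (q : ℝ) ≤ x → ∀ T : ℝ, 2 ≤ T → T ≤ x → ∀ τ : ℝ, |τ| ≤ x → ∀ Z : Finset ℂ, (∀ ρ : ℂ, ρ ∈ Z ↔ (χ.LFunction ρ = 0 ∧ 1 / 2 ≤ ρ.re ∧ ρ.re < 1 ∧ |ρ.im - τ| ≤ T)) → ‖(∑ n ∈ Finset.Icc 1 x, (ArithmeticFunction.vonMangoldt n : ℂ) * χ n * Complex.exp (-(τ * Real.log n) * Complex.I)) + ∑ ρ ∈ Z, (analyticOrderNatAt χ.LFunction ρ : ℂ) * (x : ℂ) ^ (ρ - τ * Complex.I) / (ρ - τ * Complex.I)‖ ≤ K * ((x : ℝ) / T + Real.sqrt x) * Real.log (q * x) ^ 3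

/-- Statement of `stub_thinBoxZeroFree` (Z): for every `κ > 0` and `A`, eventually every zero `s` of
every `L(s,χ)`, `χ ≠ χ₀ mod q ≤ x^{1−κ}`, with `|Im s| ≤ x` has `Re s ≤ 1 − A log log x / log x`. -/
def Sig.stub_thinBoxZeroFree : Prop :=
  ∀ κ : ℝ, 0 < κ → ∀ A : ℝ, ∃ x₀ : ℕ, ∀ x : ℕ, x₀ ≤ x → ∀ (q : ℕ) [NeZero q], (q : ℝ) ≤ (x : ℝ) ^ (1 - κ) → ∀ χ : DirichletCharacter ℂ q, χ ≠ 1 → ∀ s : ℂ, χ.LFunction s = 0 → |s.im| ≤ x → s.re ≤ 1 - A * Real.log (Real.log x) / Real.log x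

/-- The BULK WINDOW DENSITY statement D consumed by `stub_zerosToVariance` (assembled below, WITHOUT
`sorry`, from `stub_windowDensitySmall` and `stub_windowDensityLarge`): for every `κ > 0` there are
`δ > 0`, `A₀`, `C`, `x₀` with `Σ_χ Σ_{ρ ∈ Z χ} m_χ(ρ) ≤ C x^{(2−δ)(1−σ)}` for all `x ≥ x₀`,
`q ≤ x^{1−κ}`, `|τ| ≤ x`, `σ ∈ [1/2, 1]` with `σ ≤ 1 − A₀ log log x/log x`, and all finite sets
`Z χ` of zeros of `L(s,χ)` (`χ ≠ χ₀`) with `Re ρ ≥ σ`, `|Im ρ − τ| ≤ 1`. -/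
def Sig.windowDensity : Prop :=
  ∀ κ : ℝ, 0 < κ → ∃ δ : ℝ, 0 < δ ∧ ∃ A₀ C : ℝ, ∃ x₀ : ℕ, ∀ x : ℕ, x₀ ≤ x → ∀ (q : ℕ) [NeZero q], (q : ℝ) ≤ (x : ℝ) ^ (1 - κ) → ∀ τ : ℝ, |τ| ≤ x → ∀ σ : ℝ, 1 / 2 ≤ σ → σ ≤ 1 → σ ≤ 1 - A₀ * Real.log (Real.log x) / Real.log x → ∀ Z : DirichletCharacter ℂ q → Finset ℂ, (∀ χ : DirichletCharacter ℂ q, ∀ ρ ∈ Z χ, χ ≠ 1 ∧ χ.LFunction ρ = 0 ∧ σ ≤ ρ.re ∧ |ρ.im - τ| ≤ 1) → (∑ χ : DirichletCharacter ℂ q, ∑ ρ ∈ Z χ, (analyticOrderNatAt χ.LFunction ρ : ℝ)) ≤ C * (x : ℝ) ^ ((2 - δ) * (1 - σ))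

/-- Statement of `stub_windowDensitySmall` (D_small): the bulk window density for `q ≤ x^{1/8}`. -/
def Sig.stub_windowDensitySmall : Prop :=
  ∃ δ : ℝ, 0 < δ ∧ ∃ A₀ C : ℝ, ∃ x₀ : ℕ, ∀ x : ℕ, x₀ ≤ x → ∀ (q : ℕ) [NeZero q], (q : ℝ) ≤ (x : ℝ) ^ (1 / 8 : ℝ) → ∀ τ : ℝ, |τ| ≤ x → ∀ σ : ℝ, 1 / 2 ≤ σ → σ ≤ 1 → σ ≤ 1 - A₀ * Real.log (Real.log x) / Real.log x → ∀ Z : DirichletCharacter ℂ q → Finset ℂ, (∀ χ : DirichletCharacter ℂ q, ∀ ρ ∈ Z χ, χ ≠ 1 ∧ χ.LFunction ρ = 0 ∧ σ ≤ ρ.re ∧ |ρ.im - τ| ≤ 1) → (∑ χ : DirichletCharacter ℂ q, ∑ ρ ∈ Z χ, (analyticOrderNatAt χ.LFunction ρ : ℝ)) ≤ C * (x : ℝ) ^ ((2 - δ) * (1 - σ))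

/-- Statement of `stub_windowDensityLarge` (D_large): the bulk window density for
`x^{1/8} < q ≤ x^{1−κ}`. -/
def Sig.stub_windowDensityLarge : Prop :=
  ∀ κ : ℝ, 0 < κ → ∃ δ : ℝ, 0 < δ ∧ ∃ A₀ C : ℝ, ∃ x₀ : ℕ, ∀ x : ℕ, x₀ ≤ x → ∀ (q : ℕ) [NeZero q], (x : ℝ) ^ (1 / 8 : ℝ) < (q : ℝ) → (q : ℝ) ≤ (x : ℝ) ^ (1 - κ) → ∀ τ : ℝ, |τ| ≤ x → ∀ σ : ℝ, 1 / 2 ≤ σ → σ ≤ 1 → σ ≤ 1 - A₀ * Real.log (Real.log x) / Real.log x → ∀ Z : DirichletCharacter ℂ q → Finset ℂ, (∀ χ : DirichletCharacter ℂ q, ∀ ρ ∈ Z χ, χ ≠ 1 ∧ χ.LFunction ρ = 0 ∧ σ ≤ ρ.re ∧ |ρ.im - τ| ≤ 1) → (∑ χ : DirichletCharacter ℂ q, ∑ ρ ∈ Z χ, (analyticOrderNatAt χ.LFunction ρ : ℝ)) ≤ C * (x : ℝ) ^ ((2 - δ) * (1 - σ))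

/-- Statement of `stub_zerosToVariance` (R): E → Z → D → the crux (hypotheses inlined verbatim). -/
def Sig.stub_zerosToVariance : Prop :=
  (∃ K : ℝ, 0 < K ∧ ∀ (q : ℕ) [NeZero q] (χ : DirichletCharacter ℂ q), χ ≠ 1 → ∀ x : ℕ, 2 ≤ x → (q : ℝ) ≤ x → ∀ T : ℝ, 2 ≤ T → T ≤ x → ∀ τ : ℝ, |τ| ≤ x → ∀ Z : Finset ℂ, (∀ ρ : ℂ, ρ ∈ Z ↔ (χ.LFunction ρ = 0 ∧ 1 / 2 ≤ ρ.re ∧ ρ.re < 1 ∧ |ρ.im - τ| ≤ T)) → ‖(∑ n ∈ Finset.Icc 1 x, (ArithmeticFunction.vonMangoldt n : ℂ) * χ n * Complex.exp (-(τ * Real.log n) * Complex.I)) + ∑ ρ ∈ Z, (analyticOrderNatAt χ.LFunction ρ : ℂ) * (x : ℂ) ^ (ρ - τ * Complex.I) / (ρ - τ * Complex.I)‖ ≤ K * ((x : ℝ) / T + Real.sqrt x) * Real.log (q * x) ^ 3) → (∀ κ : ℝ, 0 < κ → ∀ A : ℝ, ∃ x₀ : ℕ, ∀ x : ℕ, x₀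 ≤ x → ∀ (q : ℕ) [NeZero q], (q : ℝ) ≤ (x : ℝ) ^ (1 - κ) → ∀ χ : DirichletCharacter ℂ q, χ ≠ 1 → ∀ s : ℂ, χ.LFunction s = 0 → |s.im| ≤ x → s.re ≤ 1 - A * Real.log (Real.log x) / Real.log x) → (∀ κ : ℝ, 0 < κ → ∃ δ : ℝ, 0 < δ ∧ ∃ A₀ C : ℝ, ∃ x₀ : ℕ, ∀ x : ℕ, x₀ ≤ x → ∀ (q : ℕ) [NeZero q], (q : ℝ) ≤ (x : ℝ) ^ (1 - κ) → ∀ τ : ℝ, |τ| ≤ x → ∀ σ : ℝ, 1 / 2 ≤ σ → σ ≤ 1 → σ ≤ 1 - A₀ * Real.log (Real.log x) / Real.log x → ∀ Z : DirichletCharacter ℂ q → Finset ℂ, (∀ χ : DirichletCharacter ℂ q, ∀ ρ ∈ Z χ, χ ≠ 1 ∧ χ.LFunction ρ = 0 ∧ σ ≤ ρ.re ∧ |ρ.im - τ| ≤ 1) → (∑ χ : DirichletCharacter ℂ q, ∑ ρ ∈ Z χ, (analyticOrderNatAt χ.LFunction ρ : ℝ)) ≤ C * (x : ℝ) ^ ((2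 - δ) * (1 - σ))) → TwistedVarianceRate

/-! ## Registered stubs (`sorry` only here; signatures self-contained over Mathlib + the crux decl) -/

/-- **E — TWISTED TRUNCATED EXPLICIT FORMULA** (Montgomery–Vaughan Thm 12.10 for `L(s+iτ,χ)`;
PROVABLE NOW, L/XL). There is `K > 0` such that for every `q ≥ 1`, every `χ ≠ χ₀ mod q`, every
integer `x ≥ 2` with `q ≤ x`, every `2 ≤ T ≤ x`, every `|τ| ≤ x`, and `Z` = the (finite) set of zeros
`ρ` of `L(s,χ)` with `1/2 ≤ Re ρ < 1`, `|Im ρ − τ| ≤ T`: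
`‖ψ(x,χ,τ) + Σ_{ρ ∈ Z} m(ρ) x^{ρ−iτ}/(ρ−iτ)‖ ≤ K (x/T + √x) log³(qx)`.
Why plausibly true: Perron for `−L'/L(s+iτ,χ)` (coefficients `|Λ(n)χ(n)n^{−iτ}| = Λ(n)`, so the
truncation error `(x/T)log²x + log x` is the untwisted one for integer `x`), contour to `Re s = −1/2`
through good heights `τ ± T'` (tree: `ExplicitFormulaPsiCharHeights`, uniform in the height), poles
at `s = 0` and `s = −iτ` (even `χ`) whose residues combine to `O(log(qx)) + b`-terms, zeros with
`0 < β < 1/2` bounded by `√x Σ 1/|ρ − iτ| ≪ √x log²(qx)` via the reflected zero-free region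
(tree: `DirichletLFunctionZeroFreeRegion.exists_zeroFree`) — the reflected exceptional zero `1 − β₁`
cancelling against the `L'/L(1 ∓ iτ, χ̄)` constant up to `x^{1−β₁} log x ≤ √x log x` (MV §12.1) —,
imprimitive `χ` reduced to `χ⋆` (`|ψ(χ) − ψ(χ⋆)| ≤ log q · log x/log 2`; zeros with `Re ρ ≥ 1/2`
coincide with multiplicity, Mathlib `DirichletCharacter.LFunction_changeLevel`). Sources:
MontgomeryVaughan2007 (Thm 12.5, 12.10, Lemma 12.7, Thm 10.17), Davenport ch. 19; tree
`Literature.NumberTheory.LFunctions.truncatedExplicitFormula_psiChar_holds`. Size: L/XL. -/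
theorem stub_twistedExplicitFormula : ∃ K : ℝ, 0 < K ∧ ∀ (q : ℕ) [NeZero q] (χ : DirichletCharacter ℂ q), χ ≠ 1 → ∀ x : ℕ, 2 ≤ x → (q : ℝ) ≤ x → ∀ T : ℝ, 2 ≤ T → T ≤ x → ∀ τ : ℝ, |τ| ≤ x → ∀ Z : Finset ℂ, (∀ ρ : ℂ, ρ ∈ Z ↔ (χ.LFunction ρ = 0 ∧ 1 / 2 ≤ ρ.re ∧ ρ.re < 1 ∧ |ρ.im - τ| ≤ T)) → ‖(∑ n ∈ Finset.Icc 1 x, (ArithmeticFunction.vonMangoldt n : ℂ) * χ n * Complex.exp (-(τ * Real.log n) * Complex.I)) + ∑ ρ ∈ Z, (analyticOrderNatAt χ.LFunction ρ : ℂ) * (x : ℂ) ^ (ρ - τ * Complex.I) / (ρ - τ * Complex.I)‖ ≤ K * ((x : ℝ) / T + Real.sqrt x) * Real.log (q * x) ^ 3 := by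
  sorry

/-- **Z — THIN-BOX ZERO-FREE REGION** (OPEN: the `q`-aspect zero-free region widened by an unbounded
factor). For every `κ > 0` and `A` there is `x₀` such that for `x ≥ x₀`, `q ≤ x^{1−κ}`, every
`χ ≠ χ₀ mod q` and every zero `s` of `L(s,χ)` with `|Im s| ≤ x`: `Re s ≤ 1 − A log log x / log x`.
GRH gives it (`Re s ≤ 1/2`); for fixed `q` it is Vinogradov–Korobov (tree, conditional:
`VinogradovKorobovDirichlet.eventually_LFunction_ne_zero`); for `q = x^θ` it is a zero-free region
`σ > 1 − (A/θ) log log q / log q`, `|t| ≤ q^{1/θ}`, beyond the classical `c/log q(|t|+1)` which is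
the state of the art for general moduli (wider regions only for smooth/powerful moduli). NECESSARY
for the crux in the shape `(1−β) log x ≥ (B/2) log log log x + O_ε(1)` (Landau/Turán), so any
refutation of Z in that shape refutes the crux. Why it might fail: Landau–Siegel; one zero at
`1 − o(log log x/log x) + iγ₀`, cond `≤ x^{1−κ}`, `|γ₀| ≤ x`. Sources: Iwaniec2006Conversations
((2.9)), HeathBrown1992PLMS, Chang2014 (smooth moduli), Iwaniec1974 (powerful moduli),
MontgomeryVaughan2007 §11; tree `DirichletLFunctionZeroFreeRegion.exists_zeroFree`. Size:
open-problem. -/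
theorem stub_thinBoxZeroFree : ∀ κ : ℝ, 0 < κ → ∀ A : ℝ, ∃ x₀ : ℕ, ∀ x : ℕ, x₀ ≤ x → ∀ (q : ℕ) [NeZero q], (q : ℝ) ≤ (x : ℝ) ^ (1 - κ) → ∀ χ : DirichletCharacter ℂ q, χ ≠ 1 → ∀ s : ℂ, χ.LFunction s = 0 → |s.im| ≤ x → s.re ≤ 1 - A * Real.log (Real.log x) / Real.log x := by
  sorry

/-- **D_small — BULK WINDOW ZERO DENSITY, SMALL MODULI `q ≤ x^{1/8}`** (PROVABLE NOW by
Ingham–Montgomery zero detection; L/XL). There are `δ > 0`, `A₀`, `C`, `x₀` such that for `x ≥ x₀`,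
`q ≤ x^{1/8}`, `|τ| ≤ x`, `σ ∈ [1/2, 1]` with `σ ≤ 1 − A₀ log log x / log x`, and finite sets `Z χ` of
zeros of `L(s,χ)` (`χ ≠ χ₀ mod q`) with `Re ρ ≥ σ`, `|Im ρ − τ| ≤ 1`:
`Σ_χ Σ_{ρ ∈ Z χ} m_χ(ρ) ≤ C x^{(2−δ)(1−σ)}`. Why plausibly true (δ < 1/8): for `1 − σ ≥ 1/15` the
Jensen count `≪ φ(q) log(qx) ≤ x^{1/8} log x` (tree: `DirichletDisc.exists_sum_zeroOrder_le_of_subset_closedBall`)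
suffices; for `σ ≥ 14/15` detect zeros of `L(s+iτ,χ)` with `M_X L` (`X = q`): class-I zeros
`≪ Y^{2(1−σ)+o(1)} (log x)^c` by the single-modulus mean value `Σ_χ |Σ a_n χ(n)|² ≤ (N+q)Σ|a_n|²`
(exact orthogonality, twist absorbed in `a_n`), class-II zeros
`≪ Y^{1/2−σ} (qx)^{1/4} log · φ(q)^{1/2} ((X+q) log)^{1/2} ≤ Y^{1/2−σ} x^{13/32} log` by POINTWISE
convexity `|L(1/2+it,χ)| ≪ (q(|t|+2))^{1/4} log`; with `Y = x^{13/16+}` both are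
`≤ C x^{(2−δ)(1−σ)}` once `(1−σ) log x ≥ A₀ log log x` absorbs `(log x)^c` — the cut `1/8` is
conservative (any `θ < 1/5` works with convexity, `θ < 1/3` with the mean square
`Σ_χ |L(1/2+it,χ)|² ≪ (q + √(q|t|)) log²`). GRH gives it with any `δ ≤ 1`. Sources: Montgomery1971
(Topics ch. 12, Thm 12.1), IwaniecKowalski2004 §10.2, MontgomeryVaughan2007; tree
`ZeroDensityIngham` (the ζ template), `LargeSieveCharacters`. Size: L/XL. -/
theorem stub_windowDensitySmall : ∃ δ : ℝ, 0 < δ ∧ ∃ A₀ C : ℝ, ∃ x₀ : ℕ, ∀ x : ℕ, x₀ ≤ x → ∀ (q : ℕ) [NeZero q], (q : ℝ) ≤ (x : ℝ) ^ (1 / 8 : ℝ) → ∀ τ : ℝ, |τ| ≤ x → ∀ σ : ℝ, 1 / 2 ≤ σ → σ ≤ 1 → σ ≤ 1 - A₀ * Real.log (Real.log x) / Real.log x → ∀ Z : DirichletCharacter ℂ q → Finset ℂ, (∀ χ : DirichletCharacter ℂ q, ∀ ρ ∈ Z χ, χ ≠ 1 ∧ χ.LFunction ρ = 0 ∧ σ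 ≤ ρ.re ∧ |ρ.im - τ| ≤ 1) → (∑ χ : DirichletCharacter ℂ q, ∑ ρ ∈ Z χ, (analyticOrderNatAt χ.LFunction ρ : ℝ)) ≤ C * (x : ℝ) ^ ((2 - δ) * (1 - σ)) := by
  sorry

/-- **D_large — BULK WINDOW ZERO DENSITY, LARGE MODULI `x^{1/8} < q ≤ x^{1−κ}`** (OPEN beyond
`q ≈ x^{1/3}`). For every `κ > 0` there are `δ > 0`, `A₀`, `C`, `x₀` such that for `x ≥ x₀`,
`x^{1/8} < q ≤ x^{1−κ}`, `|τ| ≤ x`, `σ ∈ [1/2,1]`, `σ ≤ 1 − A₀ log log x/log x` and finite sets `Z χ`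
of zeros (`χ ≠ χ₀`, `Re ρ ≥ σ`, `|Im ρ − τ| ≤ 1`): `Σ_χ Σ_{ρ ∈ Z χ} m_χ(ρ) ≤ C x^{(2−δ)(1−σ)}`.
GRH gives it with `δ = κ` (only `σ = 1/2` is non-void). For `q = x^θ` it is a zero-density theorem
for the `q`-family in UNIT windows at height `≤ x = q^{1/θ}` with exponent `(2−δ)/θ` in `q`:
Ingham–Montgomery detection (class II needs `Y ≥ x^{(1+3θ)/2+}`, class I `Y ≤ x^{1−}`) reaches
`θ < 1/3`; at `θ = 1/2` the exponent `4`, at `θ → 1` the DENSITY HYPOTHESIS in the `q`-aspect —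
nothing of the kind is known (full-height counts give `(qx)^{c(1−σ)}`, `c ≥ 12/5`, useless here since
`c(1+θ) > 2`). Morally NECESSARY for the crux (`N` characters with a zero at `β ≥ σ` near `τ` force
`Σ_χ|ψ(x',χ,τ)|² ≫ N x'^{2σ}/polylog` for some `x' ∈ [x, 2x]`). Why it might fail: `x^{0.6(1−κ)}`
characters mod `q = x^{1−κ}` with one zero each at `β = 3/4` near a common height — allowed by every
known density theorem — break it (and the crux, for `κ < 1/6`). Sources: Montgomery1971, Huxley1972,
Jutila1977Linnik, HeathBrown1992PLMS, IwaniecKowalski2004 ch. 10, GuthMaynard2024 (large values);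
tree `LogFreeDensityTheorem14.logFreeDensity_dirichlet`, `HuxleyZeroDensity`. Size: open-problem
(`θ ≥ 1/3`), XL (`1/8 < θ < 1/3`). -/
theorem stub_windowDensityLarge : ∀ κ : ℝ, 0 < κ → ∃ δ : ℝ, 0 < δ ∧ ∃ A₀ C : ℝ, ∃ x₀ : ℕ, ∀ x : ℕ, x₀ ≤ x → ∀ (q : ℕ) [NeZero q], (x : ℝ) ^ (1 / 8 : ℝ) < (q : ℝ) → (q : ℝ) ≤ (x : ℝ) ^ (1 - κ) → ∀ τ : ℝ, |τ| ≤ x → ∀ σ : ℝ, 1 / 2 ≤ σ → σ ≤ 1 → σ ≤ 1 - A₀ * Real.log (Real.log x) / Real.log x → ∀ Z : DirichletCharacter ℂ q → Finset ℂ, (∀ χ : DirichletCharacter ℂ q, ∀ ρ ∈ Z χ, χ ≠ 1 ∧ χ.LFunction ρ = 0 ∧ σ ≤ ρ.re ∧ |ρ.im - τ| ≤ 1) → (∑ χ : DirichletCharacter ℂ q, ∑ ρ ∈ Z χ, (analyticOrderNatAt χ.LFunction ρ : ℝ)) ≤ C * (x : ℝ) ^ ((2 - δ) * (1 - σ)) :=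 by
  sorry

/-- **R — FROM ZEROS TO THE TWISTED CLASS VARIANCE** (PROVABLE NOW, M/L; the TRANSFER stub
`C⁺ → crux` with `C⁺ = E ∧ Z ∧ D`). Proof: Parseval `φ(q) V_Λ(x;q,τ) = Σ_{χ≠χ₀}|ψ(x,χ̄,τ)|²`
(Mathlib `DirichletCharacter.sum_char_inv_mul_char_eq`; `q ∈ {1,2}` gives `V = 0`); E at `T = √x`
(`x ≥ 4`): `|ψ|² ≤ 2|S_χ|² + 8K²x·(2 log x)⁶`, summed over `φ(q) ≤ x^{1−κ}` characters
`≪ x^{2−κ} log⁶ x`; `|S_χ| ≤ 4 Σ_k (1+k)^{-1} Σ_{ρ ∈ W_k(χ)} m x^β` over the windows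
`W_k = {k ≤ |γ−τ| < k+1}`, `k ≤ √x`; Cauchy–Schwarz twice with the tree's per-character window count
`Σ_{ρ ∈ W_k(χ)} m ≤ 2C_J log(q(2x+5))` (`DirichletDisc.exists_sum_zeroOrder_le_of_subset_closedBall`,
all `χ ≠ χ₀`, radius `81/50`) ⟹ `Σ_χ |S_χ|² ≤ 64 C_J log³(3x) · max_k 𝒲_k`,
`𝒲_k = Σ_χ Σ_{ρ ∈ W_k(χ)} m x^{2β}`; Z at scale `2x` with `A ≥ A₀ + 1`: every `ρ` in play has depth
`1 − β ≥ A log log(2x)/log(2x) ≥ A₀ log log(2x)/log(2x)`; D at scale `2x` (windows centred at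
`τ ± (k + 1/2)`, `|centre| ≤ 2x`) and partial summation over depth bins of width `1/log x`:
`𝒲_k ≤ 8C e² (1 − e^{−δ})^{-1} x² (log x)^{−δA/2}`; choose `A > max(A₀ + 1, 10/δ)`, then `x₀`.
Why it might fail: it does not (bookkeeping; the delicate points — zeros with `β < 1/2`, the
constant term, imprimitive characters — are inside E by design). Sources: MontgomeryVaughan2007
§§12.1, 13.1; Davenport ch. 20. Size: M/L. -/
theorem stub_zerosToVariance : (∃ K : ℝ, 0 < K ∧ ∀ (q : ℕ) [NeZero q] (χ : DirichletCharacter ℂ q), χ ≠ 1 → ∀ x : ℕ, 2 ≤ x → (q : ℝ) ≤ x → ∀ T : ℝ, 2 ≤ T → T ≤ x → ∀ τ : ℝ, |τ| ≤ x → ∀ Z : Finset ℂ, (∀ ρ : ℂ, ρ ∈ Z ↔ (χ.LFunction ρ = 0 ∧ 1 / 2 ≤ ρ.re ∧ ρ.re < 1 ∧ |ρ.im - τ| ≤ T)) → ‖(∑ n ∈ Finset.Icc 1 x, (ArithmeticFunction.vonMangoldt n : ℂ) * χ n * Complex.exp (-(τ * Real.log n) * Complex.I)) + ∑ ρ ∈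 Z, (analyticOrderNatAt χ.LFunction ρ : ℂ) * (x : ℂ) ^ (ρ - τ * Complex.I) / (ρ - τ * Complex.I)‖ ≤ K * ((x : ℝ) / T + Real.sqrt x) * Real.log (q * x) ^ 3) → (∀ κ : ℝ, 0 < κ → ∀ A : ℝ, ∃ x₀ : ℕ, ∀ x : ℕ, x₀ ≤ x → ∀ (q : ℕ) [NeZero q], (q : ℝ) ≤ (x : ℝ) ^ (1 - κ) → ∀ χ : DirichletCharacter ℂ q, χ ≠ 1 → ∀ s : ℂ, χ.LFunction s = 0 → |s.im| ≤ x → s.re ≤ 1 - A * Real.log (Real.log x) / Real.log x) → (∀ κ : ℝ, 0 < κ → ∃ δ : ℝ, 0 < δ ∧ ∃ A₀ C : ℝ, ∃ x₀ : ℕ, ∀ x : ℕ, x₀ ≤ x → ∀ (q : ℕ) [NeZero q], (q : ℝ) ≤ (x : ℝ) ^ (1 - κ) → ∀ τ : ℝ, |τ| ≤ x → ∀ σ : ℝ, 1 / 2 ≤ σ → σ ≤ 1 → σ ≤ 1 - A₀ * Real.log (Real.log x) / Real.log x → ∀ Z : DirichletCharacter ℂ q → Finset ℂ, (∀ χ :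 DirichletCharacter ℂ q, ∀ ρ ∈ Z χ, χ ≠ 1 ∧ χ.LFunction ρ = 0 ∧ σ ≤ ρ.re ∧ |ρ.im - τ| ≤ 1) → (∑ χ : DirichletCharacter ℂ q, ∑ ρ ∈ Z χ, (analyticOrderNatAt χ.LFunction ρ : ℝ)) ≤ C * (x : ℝ) ^ ((2 - δ) * (1 - σ))) → TwistedVarianceRate := by
  sorry

/-! ## Glue (no `sorry`): the bulk window density D from its two modulus ranges -/

private theorem loglog_div_log_nonneg {x : ℕ} (hx : 3 ≤ x) :
    0 ≤ Real.log (Real.log (x : ℝ)) / Real.log x := by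
  have hx' : (3 : ℝ) ≤ (x : ℝ) := by exact_mod_cast hx
  have hlog : 1 < Real.log (x : ℝ) := by
    rw [Real.lt_log_iff_exp_lt (by linarith)]
    exact lt_of_lt_of_le Real.exp_one_lt_three hx'
  exact div_nonneg (Real.log_nonneg hlog.le) (by linarith)

private theorem cutoff_mono {A A' : ℝ} (hA : A' ≤ A) {x : ℕ} (hx : 3 ≤ x) {σ : ℝ}
    (h : σ ≤ 1 - A * Real.log (Real.log (x : ℝ)) / Real.log x) :
    σ ≤ 1 - A' * Real.log (Real.log (x : ℝ)) / Real.log x := by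
  have hq := loglog_div_log_nonneg hx
  have : A' * Real.log (Real.log (x : ℝ)) / Real.log x ≤ A * Real.log (Real.log (x : ℝ)) / Real.log x := by
    rw [mul_div_assoc, mul_div_assoc]
    exact mul_le_mul_of_nonneg_right hA hq
  linarith

private theorem bound_mono {C C' δ δ' σ : ℝ} {x : ℕ} (hx : 1 ≤ x) (hC : C' ≤ C) (hC0 : 0 ≤ C)
    (hδ : δ ≤ δ') (hσ : σ ≤ 1) {S : ℝ} (hS : S ≤ C' * (x : ℝ) ^ ((2 - δ') * (1 - σ))) :
    S ≤ C * (x : ℝ) ^ ((2 - δ) * (1 - σ)) := by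
  have hx1 : (1 : ℝ) ≤ (x : ℝ) := by exact_mod_cast hx
  have hpos : 0 ≤ (x : ℝ) ^ ((2 - δ') * (1 - σ)) := Real.rpow_nonneg (by linarith) _
  have hexp : (2 - δ') * (1 - σ) ≤ (2 - δ) * (1 - σ) :=
    mul_le_mul_of_nonneg_right (by linarith) (by linarith)
  have hpow : (x : ℝ) ^ ((2 - δ') * (1 - σ)) ≤ (x : ℝ) ^ ((2 - δ) * (1 - σ)) :=
    Real.rpow_le_rpow_of_exponent_le hx1 hexp
  calc S ≤ C' * (x : ℝ) ^ ((2 - δ') * (1 - σ)) := hS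
    _ ≤ C * (x : ℝ) ^ ((2 - δ') * (1 - σ)) := mul_le_mul_of_nonneg_right hC hpos
    _ ≤ C * (x : ℝ) ^ ((2 - δ) * (1 - σ)) := mul_le_mul_of_nonneg_left hpow hC0

/-- **D from D_small and D_large** (real proof): given `κ`, take `δ = min δ₁ δ₂`, `A₀ = max A₁ A₂`,
`C = max (max C₁ C₂) 0`, `x₀ = max (max x₁ x₂) 3` and split at `q = x^{1/8}`. -/
theorem windowDensity_of :
    Sig.stub_windowDensitySmall → Sig.stub_windowDensityLarge → Sig.windowDensity := by
  intro hs hl κ hκ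
  obtain ⟨δ₁, hδ₁, A₁, C₁, x₁, h₁⟩ := hs
  obtain ⟨δ₂, hδ₂, A₂, C₂, x₂, h₂⟩ := hl κ hκ
  refine ⟨min δ₁ δ₂, lt_min hδ₁ hδ₂, max A₁ A₂, max (max C₁ C₂) 0, max (max x₁ x₂) 3, ?_⟩
  intro x hx q _ hq τ hτ σ hσ hσ1 hσA Z hZ
  have hx₁ : x₁ ≤ x := le_trans (le_trans (le_max_left _ _) (le_max_left _ _)) hx
  have hx₂ : x₂ ≤ x := le_trans (le_trans (le_max_right _ _) (le_max_left _ _)) hx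
  have hx3 : 3 ≤ x := le_trans (le_max_right _ _) hx
  have hx1 : 1 ≤ x := le_trans (by norm_num) hx3
  have hC0 : 0 ≤ max (max C₁ C₂) 0 := le_max_right _ _
  rcases le_or_gt (q : ℝ) ((x : ℝ) ^ (1 / 8 : ℝ)) with hsmall | hlarge
  · have hσA₁ : σ ≤ 1 - A₁ * Real.log (Real.log (x : ℝ)) / Real.log x :=
      cutoff_mono (le_max_left _ _) hx3 hσA
    have := h₁ x hx₁ q hsmall τ hτ σ hσ hσ1 hσA₁ Z hZ
    exact bound_mono hx1 (le_trans (le_max_left _ _) (le_max_left _ _)) hC0 (min_le_left _ _) hσ1 this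
  · have hσA₂ : σ ≤ 1 - A₂ * Real.log (Real.log (x : ℝ)) / Real.log x :=
      cutoff_mono (le_max_right _ _) hx3 hσA
    have hlarge' : (x : ℝ) ^ (1 / 8 : ℝ) < (q : ℝ) := hlarge
    have := h₂ x hx₂ q hlarge' hq τ hτ σ hσ hσ1 hσA₂ Z hZ
    exact bound_mono hx1 (le_trans (le_max_right _ _) (le_max_left _ _)) hC0 (min_le_right _ _) hσ1 this

/-! ## Composition: the crux BY NAME from the five stubs -/

/-- **TwistedVarianceRate from E, Z, D_small, D_large, R.** -/
theorem TwistedVarianceRate_of :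
    Sig.stub_twistedExplicitFormula → Sig.stub_thinBoxZeroFree → Sig.stub_windowDensitySmall →
      Sig.stub_windowDensityLarge → Sig.stub_zerosToVariance → TwistedVarianceRate :=
  fun hE hZ hDs hDl hR => hR hE hZ (windowDensity_of hDs hDl)

/-- The crux by name, closed modulo the five registered stubs (checks that the `Sig.*` legend is the
stub signatures verbatim). -/
theorem twistedVarianceRate_of_stubs : TwistedVarianceRate :=
  TwistedVarianceRate_of stub_twistedExplicitFormula stub_thinBoxZeroFree stub_windowDensitySmall
    stub_windowDensityLarge stub_zerosToVariance

/-! ## Sanity (no `sorry`): the full-range density D restricts to both halves (the cut is exact) -/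

theorem windowDensitySmall_of (h : Sig.windowDensity) : Sig.stub_windowDensitySmall := by
  obtain ⟨δ, hδ, A₀, C, x₀, h⟩ := h (7 / 8) (by norm_num)
  refine ⟨δ, hδ, A₀, C, x₀, ?_⟩
  intro x hx q _ hq τ hτ σ hσ hσ1 hσA Z hZ
  have h78 : (1 : ℝ) - 7 / 8 = 1 / 8 := by norm_num
  exact h x hx q (by rw [h78]; exact hq) τ hτ σ hσ hσ1 hσA Z hZ

theorem windowDensityLarge_of (h : Sig.windowDensity) : Sig.stub_windowDensityLarge := by
  intro κ hκ
  obtain ⟨δ, hδ, A₀, C, x₀, h⟩ := h κ hκ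
  exact ⟨δ, hδ, A₀, C, x₀, fun x hx q _ _ hq τ hτ σ hσ hσ1 hσA Z hZ => h x hx q hq τ hτ σ hσ hσ1 hσA Z hZ⟩

theorem windowDensity_iff :
    Sig.windowDensity ↔ (Sig.stub_windowDensitySmall ∧ Sig.stub_windowDensityLarge) :=
  ⟨fun h => ⟨windowDensitySmall_of h, windowDensityLarge_of h⟩, fun h => windowDensity_of h.1 h.2⟩

end Summit.Parity.GeneralizedHardyLittlewood.Cruxes.TwistedVarianceRate.Zeros

end
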